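import Summits.ResolutionOfSingularities.ResolutionOfSingularities.Theorems.FrobeniusClosingSteerEtaleResidueLiftMaps
import Summits.ResolutionOfSingularities.ResolutionOfSingularities.Theorems.FrobeniusClosingSteerIsolatedEtaleLift
import Summits.ResolutionOfSingularities.ResolutionOfSingularities.Theorems.FrobeniusClosingSteerRadicandCohenFrame
import Summits.ResolutionOfSingularities.ResolutionOfSingularities.Theorems.FrobeniusClosingSteerSigmaTopLegalityOddDivisor
import HarnessLib

/-!
# [OURS · L0 W4.1] K3-a part 4, stage B1: ONE LEVEL of the window, READ INSIDE A FIELD — the range of an injective `(S[X]/(P))_𝔫 → L′`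
# (chain W4.1 `FrobeniusClosingSteer`, crux stmt-ResolutionOfSingularities-16345; K3 route (R1), RULINGs 250(a)/258; interface
# `D/res-D-lib-1/K3WindowInterface.lean` 1dc250035b4b213c; `--supports … --as helper`)

HONEST FRAMING. OURS kernel (HIRONAKA-L librarian res-D-lib-1 gen 7). The conjuncts of the word `EtaleLift.LevelLift S S′ ψ θ′`
(`…SteerEtaleWindowWords`, review-queued p561951) for `S′ := j.range ⊆ L′`, where `T := (S[X]/(P))_𝔫` is the étale residue enlargement of
`…SteerEtaleResidueLift` and `j : T → L′` is an INJECTIVE ring map into a field (in the window: `L′ = Frac T₃`, `j = T_i ↪ T₃ → L′`,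
`…SteerEtaleResidueLiftMaps.localization_map_injective`), `ψ := j ∘ (S → T)` and `θ′ := j(x)`:
`isLocalRing_range`, `isLocalHom_rangeLift`, `map_maximalIdeal_rangeLift` (unramified), `comap_map_rangeLift` (faithfully flat descent),
`mem_closure_of_adjoinRoot` / `exists_div_of_mem_range` (GENERATION by `ψ(S)` and `θ′` up to units), `isRegularLocalRing_range`, `ringKrullDim_range`,
`isExcellentRing_range`, `perfectField_residueField_range`, `hasIsolatedSingularity_radicand_range` (res-D-pv-040's K3-c
`IsolatedEtaleLift.hasIsolatedSingularity_radicand_of_etale_localization` BY NAME + transport), `eval₂_rangeLift_root` (the monic relation of `θ′`).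
The packaging into `LevelLift` and the four-level assembly `exists_rational_window_lift` follow once the words file lands.
Nothing here is a statement of H. Hironaka's manuscript [Hironaka2017]. AI-written; AI review is weaker than expert review. [cite: StacksProject, Tag 00TV]
-/

set_option linter.dupNamespace false

noncomputable section

namespace Summit.ResolutionOfSingularities.ResolutionOfSingularities.Theorems.SwitchingDichotomy.EtaleLift

open IsLocalRing Polynomial Literature.AlgebraicGeometry.Resolution
open Summit.ResolutionOfSingularities.ResolutionOfSingularities.Theorems.SwitchingDichotomy.SigmaTopLegality

section RangeLevel

variable {S : Type} [CommRing S] [IsLocalRing S] (P : S[X]) {k' : Type} [Field k'] (φ : ResidueField S →+* k') (θ : k')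
  (hθ : P.eval₂ (φ.comp (residue S)) θ = 0) {L' : Type} [Field L']

/-! ### The range of an injective map of a local ring into a field -/

/-- The range of an injective ring map `j : T → L′` of a local ring is a local ring (it is isomorphic to `T`). [folklore] -/
theorem isLocalRing_range {T : Type} [CommRing T] [IsLocalRing T] (j : T →+* L') : IsLocalRing j.range :=
  IsLocalRing.of_surjective' j.rangeRestrict j.rangeRestrict_surjective

/-- The bijection `T ≃ j.range` for `j` injective (as a ring isomorphism, rebuilt where needed). [folklore] -/
theorem bijective_rangeRestrict {T : Type} [CommRing T] (j : T →+* L') (hj : Function.Injective j) :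
    Function.Bijective j.rangeRestrict :=
  ⟨fun _ _ h => hj (congrArg Subtype.val h), j.rangeRestrict_surjective⟩

/-! ### The level data -/

/-- `ψ := j ∘ (S → T)` is a local homomorphism onto the local ring `j.range`. [folklore] -/
theorem isLocalHom_rangeLift (hP : P.Monic)
    (j : (haveI := isMaximal_ker_lift P φ θ hθ hP;
      Localization.AtPrime (RingHom.ker (AdjoinRoot.lift (φ.comp (residue S)) θ hθ))) →+* L') (hj : Function.Injective j) :
    haveI := isMaximal_ker_lift P φ θ hθ hP
    haveI := isLocalRing_range j
    IsLocalHom (j.rangeRestrict.comp (algebraMap S _)) := by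
  haveI := isMaximal_ker_lift P φ θ hθ hP
  haveI := isLocalRing_range j
  haveI := isLocalHom_algebraMap_localization_ker_lift P φ θ hθ hP
  set T := Localization.AtPrime (RingHom.ker (AdjoinRoot.lift (φ.comp (residue S)) θ hθ))
  let e : T ≃+* j.range := RingEquiv.ofBijective j.rangeRestrict (bijective_rangeRestrict j hj)
  have he : j.rangeRestrict = (e : T →+* j.range) := rfl
  rw [he]
  exact RingHom.isLocalHom_comp _ _

/-- **Unramified**: `𝔪_S · j.range = 𝔪_{j.range}` along `ψ := j ∘ (S → T)`. [cite: StacksProject, Tag 00UW] -/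
theorem map_maximalIdeal_rangeLift (hP : P.Monic) (hsep : (P.map (residue S)).Separable)
    (j : (haveI := isMaximal_ker_lift P φ θ hθ hP;
      Localization.AtPrime (RingHom.ker (AdjoinRoot.lift (φ.comp (residue S)) θ hθ))) →+* L') (hj : Function.Injective j) :
    haveI := isMaximal_ker_lift P φ θ hθ hP
    haveI := isLocalRing_range j
    (maximalIdeal S).map (j.rangeRestrict.comp (algebraMap S _)) = maximalIdeal j.range := by
  haveI := isMaximal_ker_lift P φ θ hθ hP
  haveI := isLocalRing_range j
  set T := Localization.AtPrime (RingHom.ker (AdjoinRoot.lift (φ.comp (residue S)) θ hθ))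
  let e : T ≃+* j.range := RingEquiv.ofBijective j.rangeRestrict (bijective_rangeRestrict j hj)
  have he : j.rangeRestrict = (e : T →+* j.range) := rfl
  rw [← Ideal.map_map, map_maximalIdeal_localization_ker_lift P φ θ hθ hP hsep]
  exact map_maximalIdeal_of_surjective j.rangeRestrict (bijective_rangeRestrict j hj).2

/-- **Faithfully flat descent form**: `ψ⁻¹(I · j.range) = I` for every ideal `I` of `S`. [folklore] -/
theorem comap_map_rangeLift (hP : P.Monic)
    (j : (haveI := isMaximal_ker_lift P φ θ hθ hP;
      Localization.AtPrime (RingHom.ker (AdjoinRoot.lift (φ.comp (residue S)) θ hθ))) →+* L') (hj : Function.Injective j)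
    (I : Ideal S) :
    haveI := isMaximal_ker_lift P φ θ hθ hP
    (I.map (j.rangeRestrict.comp (algebraMap S _))).comap (j.rangeRestrict.comp (algebraMap S _)) = I := by
  haveI := isMaximal_ker_lift P φ θ hθ hP
  set T := Localization.AtPrime (RingHom.ker (AdjoinRoot.lift (φ.comp (residue S)) θ hθ))
  haveI := faithfullyFlat_localization_ker_lift P φ θ hθ hP
  rw [← Ideal.map_map, ← Ideal.comap_comap, Ideal.comap_map_of_bijective _ (bijective_rangeRestrict j hj)]
  exact Ideal.comap_map_eq_self_of_faithfullyFlat I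

/-- The root read in `L′`: `θ′ := j(x) ∈ j.range`. [folklore] -/
theorem root_mem_range (hP : P.Monic)
    (j : (haveI := isMaximal_ker_lift P φ θ hθ hP;
      Localization.AtPrime (RingHom.ker (AdjoinRoot.lift (φ.comp (residue S)) θ hθ))) →+* L') :
    haveI := isMaximal_ker_lift P φ θ hθ hP
    j (algebraMap (AdjoinRoot P) _ (AdjoinRoot.root P)) ∈ j.range := ⟨_, rfl⟩

/-- **The monic relation of `θ′`** read in `L′`: `P(θ′) = 0` through `ψ`. [folklore] -/
theorem eval₂_rangeLift_root (hP : P.Monic)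
    (j : (haveI := isMaximal_ker_lift P φ θ hθ hP;
      Localization.AtPrime (RingHom.ker (AdjoinRoot.lift (φ.comp (residue S)) θ hθ))) →+* L') :
    haveI := isMaximal_ker_lift P φ θ hθ hP
    P.eval₂ (j.range.subtype.comp (j.rangeRestrict.comp (algebraMap S _)))
      (j (algebraMap (AdjoinRoot P) _ (AdjoinRoot.root P))) = 0 := by
  haveI := isMaximal_ker_lift P φ θ hθ hP
  set T := Localization.AtPrime (RingHom.ker (AdjoinRoot.lift (φ.comp (residue S)) θ hθ))
  have hcomp : j.range.subtype.comp (j.rangeRestrict.comp (algebraMap S T)) =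
      (j.comp (algebraMap (AdjoinRoot P) T)).comp (AdjoinRoot.of P) := by
    ext s
    change j (algebraMap S T s) = j (algebraMap (AdjoinRoot P) T (AdjoinRoot.of P s))
    rw [IsScalarTower.algebraMap_apply S (AdjoinRoot P) T, AdjoinRoot.algebraMap_eq]
  rw [hcomp]
  change P.eval₂ ((j.comp (algebraMap (AdjoinRoot P) T)).comp (AdjoinRoot.of P))
    ((j.comp (algebraMap (AdjoinRoot P) T)) (AdjoinRoot.root P)) = 0
  rw [← Polynomial.hom_eval₂, AdjoinRoot.eval₂_root, map_zero]

/-- Every element of `S[X]/(P)`, read in `L′`, lies in the subring generated by `ψ(S)` and `θ′`. [folklore] -/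
theorem mem_closure_of_adjoinRoot (hP : P.Monic)
    (j : (haveI := isMaximal_ker_lift P φ θ hθ hP;
      Localization.AtPrime (RingHom.ker (AdjoinRoot.lift (φ.comp (residue S)) θ hθ))) →+* L') (a : AdjoinRoot P) :
    haveI := isMaximal_ker_lift P φ θ hθ hP
    j (algebraMap (AdjoinRoot P) _ a) ∈
      Subring.closure (Set.range (fun s : S => ((j.rangeRestrict.comp (algebraMap S _) s : j.range) : L')) ∪
        {j (algebraMap (AdjoinRoot P) _ (AdjoinRoot.root P))}) := by
  haveI := isMaximal_ker_lift P φ θ hθ hP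
  set T := Localization.AtPrime (RingHom.ker (AdjoinRoot.lift (φ.comp (residue S)) θ hθ))
  set C := Subring.closure (Set.range (fun s : S => ((j.rangeRestrict.comp (algebraMap S T) s : j.range) : L')) ∪
        {j (algebraMap (AdjoinRoot P) T (AdjoinRoot.root P))})
  obtain ⟨q, rfl⟩ := AdjoinRoot.mk_surjective a
  rw [← AdjoinRoot.aeval_eq]
  induction q using Polynomial.induction_on with
  | C c =>
    rw [Polynomial.aeval_C, AdjoinRoot.algebraMap_eq, ← AdjoinRoot.algebraMap_eq, ← IsScalarTower.algebraMap_apply]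
    exact Subring.subset_closure (Or.inl ⟨c, rfl⟩)
  | add q₁ q₂ h₁ h₂ =>
    rw [map_add, map_add, map_add]
    exact Subring.add_mem _ h₁ h₂
  | monomial n c ih =>
    rw [pow_succ, ← mul_assoc, map_mul, map_mul, map_mul, Polynomial.aeval_X]
    exact Subring.mul_mem _ ih (Subring.subset_closure (Or.inr rfl))

/-- **Generation**: every `z ∈ j.range` is `u / v` with `u, v` in the subring generated by `ψ(S)` and `θ′`, and `v` a unit of `j.range`. [folklore] -/
theorem exists_div_of_mem_range (hP : P.Monic)
    (j : (haveI := isMaximal_ker_lift P φ θ hθ hP;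
      Localization.AtPrime (RingHom.ker (AdjoinRoot.lift (φ.comp (residue S)) θ hθ))) →+* L') (hj : Function.Injective j)
    (z : L') (hz : z ∈ j.range) :
    haveI := isMaximal_ker_lift P φ θ hθ hP
    ∃ u ∈ Subring.closure (Set.range (fun s : S => ((j.rangeRestrict.comp (algebraMap S _) s : j.range) : L')) ∪
        {j (algebraMap (AdjoinRoot P) _ (AdjoinRoot.root P))}),
      ∃ v ∈ Subring.closure (Set.range (fun s : S => ((j.rangeRestrict.comp (algebraMap S _) s : j.range) : L')) ∪
        {j (algebraMap (AdjoinRoot P) _ (AdjoinRoot.root P))}), v⁻¹ ∈ j.range ∧ z = u / v := by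
  haveI := isMaximal_ker_lift P φ θ hθ hP
  set 𝔫 := RingHom.ker (AdjoinRoot.lift (φ.comp (residue S)) θ hθ)
  set T := Localization.AtPrime 𝔫
  obtain ⟨t, rfl⟩ := hz
  obtain ⟨⟨a, s⟩, rfl⟩ := IsLocalization.mk'_surjective 𝔫.primeCompl t
  dsimp only
  have hsu : IsUnit (algebraMap (AdjoinRoot P) T (s : AdjoinRoot P)) := IsLocalization.map_units T s
  refine ⟨j (algebraMap (AdjoinRoot P) T a), mem_closure_of_adjoinRoot P φ θ hθ hP j a,
    j (algebraMap (AdjoinRoot P) T (s : AdjoinRoot P)), mem_closure_of_adjoinRoot P φ θ hθ hP j s, ?_, ?_⟩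
  · obtain ⟨u, hu⟩ := hsu
    refine ⟨(↑u⁻¹ : T), ?_⟩
    rw [← hu]
    exact (inv_eq_of_mul_eq_one_left (by rw [← map_mul, Units.inv_mul, map_one])).symm
  · have hv0 : j (algebraMap (AdjoinRoot P) T (s : AdjoinRoot P)) ≠ 0 := by
      rw [Ne, ← map_zero j, hj.eq_iff]
      exact hsu.ne_zero
    rw [eq_div_iff hv0, ← map_mul, IsLocalization.mk'_spec]

/-- **Regularity** of `j.range` from regularity of `S`. [cite: StacksProject, Tag 00TV] -/
theorem isRegularLocalRing_range (hreg : IsRegularLocalRing S) (hP : P.Monic) (hsep : (P.map (residue S)).Separable)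
    (j : (haveI := isMaximal_ker_lift P φ θ hθ hP;
      Localization.AtPrime (RingHom.ker (AdjoinRoot.lift (φ.comp (residue S)) θ hθ))) →+* L') (hj : Function.Injective j) :
    IsRegularLocalRing j.range := by
  haveI := isMaximal_ker_lift P φ θ hθ hP
  haveI := isRegularLocalRing_localization_ker_lift P φ θ hθ hreg hP hsep
  exact IsRegularLocalRing.of_ringEquiv (RingEquiv.ofBijective j.rangeRestrict (bijective_rangeRestrict j hj))

/-- **Dimension**: `dim j.range = dim S`. [cite: StacksProject, Tag 00TV] -/
theorem ringKrullDim_range [IsNoetherianRing S] (hP : P.Monic) (hsep : (P.map (residue S)).Separable)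
    (j : (haveI := isMaximal_ker_lift P φ θ hθ hP;
      Localization.AtPrime (RingHom.ker (AdjoinRoot.lift (φ.comp (residue S)) θ hθ))) →+* L') (hj : Function.Injective j) :
    ringKrullDim j.range = ringKrullDim S := by
  haveI := isMaximal_ker_lift P φ θ hθ hP
  rw [← ringKrullDim_eq_of_ringEquiv (RingEquiv.ofBijective j.rangeRestrict (bijective_rangeRestrict j hj)),
    ringKrullDim_localization_ker_lift P φ θ hθ hP hsep]

/-- **Excellence** of `j.range` from excellence of `S`. [cite: Matsumura1987, §32 p. 260] -/
theorem isExcellentRing_range (hP : P.Monic) (hexc : IsExcellentRing S)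
    (j : (haveI := isMaximal_ker_lift P φ θ hθ hP;
      Localization.AtPrime (RingHom.ker (AdjoinRoot.lift (φ.comp (residue S)) θ hθ))) →+* L') (hj : Function.Injective j) :
    IsExcellentRing j.range := by
  haveI := isMaximal_ker_lift P φ θ hθ hP
  set T := Localization.AtPrime (RingHom.ker (AdjoinRoot.lift (φ.comp (residue S)) θ hθ))
  have hT := isExcellentRing_localization_ker_lift P φ θ hθ hP hexc
  let e : T ≃+* j.range := RingEquiv.ofBijective j.rangeRestrict (bijective_rangeRestrict j hj)
  letI : Algebra T j.range := (e : T →+* j.range).toAlgebra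
  have hft : Algebra.FiniteType T j.range := RingHom.FiniteType.of_surjective (e : T →+* j.range) e.surjective
  exact hT.of_essFiniteType (Algebra.EssFiniteType.of_finiteType T j.range)

/-- **Perfect residue field** of `j.range` from that of `S`. [folklore] -/
theorem perfectField_residueField_range (hP : P.Monic) [PerfectField (ResidueField S)]
    (j : (haveI := isMaximal_ker_lift P φ θ hθ hP;
      Localization.AtPrime (RingHom.ker (AdjoinRoot.lift (φ.comp (residue S)) θ hθ))) →+* L') (hj : Function.Injective j) :
    haveI := isLocalRing_range j
    PerfectField (ResidueField j.range) := by
  haveI := isMaximal_ker_lift P φ θ hθ hP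
  haveI := isLocalRing_range j
  haveI := perfectField_residueField_localization_ker_lift P φ θ hθ hP
  exact PerfectField.of_ringEquiv
    (ResidueField.mapEquiv (RingEquiv.ofBijective j.rangeRestrict (bijective_rangeRestrict j hj)))

/-- **Isolatedness of the `2`-radicand germ** transfers to `j.range` (res-D-pv-040's K3-c
`IsolatedEtaleLift.hasIsolatedSingularity_radicand_of_etale_localization` for `S → T`, then the ring isomorphism `T ≅ j.range`). [cite: StacksProject, Tag 00TV] -/
theorem hasIsolatedSingularity_radicand_range [IsNoetherianRing S] (p : ℕ) [Fact p.Prime] (hP : P.Monic) (hsep : (P.map (residue S)).Separable)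
    (j : (haveI := isMaximal_ker_lift P φ θ hθ hP;
      Localization.AtPrime (RingHom.ker (AdjoinRoot.lift (φ.comp (residue S)) θ hθ))) →+* L') (hj : Function.Injective j)
    (f : S) (hiso : HasIsolatedSingularity (RadicandRing S p f)) :
    haveI := isMaximal_ker_lift P φ θ hθ hP
    HasIsolatedSingularity (RadicandRing j.range p (j.rangeRestrict.comp (algebraMap S _) f)) := by
  haveI := isMaximal_ker_lift P φ θ hθ hP
  haveI := etale_adjoinRoot P hP hsep
  haveI : Module.Finite S (AdjoinRoot P) := hP.finite_adjoinRoot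
  set 𝔫 := RingHom.ker (AdjoinRoot.lift (φ.comp (residue S)) θ hθ)
  set T := Localization.AtPrime 𝔫
  have hT : Words.HasIsolatedSingularity (Words.RadicandRing T p (algebraMap S T f)) :=
    IsolatedEtaleLift.hasIsolatedSingularity_radicand_of_etale_localization (S := S) (A := AdjoinRoot P) (S' := T) 𝔫 p f hiso
  let e : T ≃+* j.range := RingEquiv.ofBijective j.rangeRestrict (bijective_rangeRestrict j hj)
  obtain ⟨e'⟩ := RadicandCohenFrame.nonempty_adjoinRoot_equiv_of_ringEquiv p e (algebraMap S T f)
  exact IsolatedEtaleLift.hasIsolatedSingularity_of_ringEquiv e' hT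

end RangeLevel

end Summit.ResolutionOfSingularities.ResolutionOfSingularities.Theorems.SwitchingDichotomy.EtaleLift

end
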